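import Mathlib
import Literature.Analysis.FluidPDE.TypeIAncientMild
import Literature.Analysis.FluidPDE.TypeIAncientMildClassical
import Literature.Analysis.FluidPDE.BarkerPrange2020VorticityAlignmentTypeIHolds
import Literature.Analysis.FluidPDE.LocalBiotSavartCalculus
import Literature.Analysis.FluidPDE.VorticityFormulationHolds
import Summits.NavierStokesRegularity.NavierStokesRegularity.Theses.SymmetryModuliCount
import Summits.NavierStokesRegularity.NavierStokesRegularity.Theorems.ClockStretchingLawClockCeilingGermRigidity
import Summits.NavierStokesRegularity.NavierStokesRegularity.Theorems.ClockStretchingLawClockLaw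
import Summits.NavierStokesRegularity.NavierStokesRegularity.Theorems.ClockStretchingLawSteadySliceLiouvilleAnalytic
import Summits.NavierStokesRegularity.NavierStokesRegularity.Theorems.ScenarioCensusPeriodicGauge
import Summits.NavierStokesRegularity.NavierStokesRegularity.Theorems.ScenarioCensusForceMeter
import Summits.NavierStokesRegularity.NavierStokesRegularity.Theorems.SymmetryModuliCountFarPastLedger
import Summits.NavierStokesRegularity.NavierStokesRegularity.Theorems.SymmetryModuliCountLinearLiouvilleSevenGaugeBounds
import Summits.NavierStokesRegularity.NavierStokesRegularity.Theorems.SymmetryModuliCountLinearLiouvilleSevenAnchorPressure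
import HarnessLib
import Literature.Analysis.FluidPDE.LeiZhang2011Proofs
import Summits.NavierStokesRegularity.NavierStokesRegularity.Theorems.SoloSalvageWu2026ConstructCompactV
import Summits.NavierStokesRegularity.NavierStokesRegularity.Theorems.UnthreadedRigidityDoorUnthreadedRigidityThreadingJets
import Summits.NavierStokesRegularity.NavierStokesRegularity.Theorems.StrainDoorsTypeIAncientCompactness

/-!
# Block A2, instrument INERTIAL METER (ns-idea-2 LINE g18-1; cells A2inV / A2inP / A2inT / A2inB / A2inA / A2inW DECIDED, A2inS / A2inG OPEN) — port, part 1/3: §A the instrument's LAW (the KNSS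
# gauge is an inertial frame: zero large-scale mean, `inertialLaw`); §B kinematics (fields read modulo boosts and potentials); §C the class read by the meter: VORTICITY-POCKET RIGIDITY
# (`vorticityPocketRigidity`); §D the cells decided by vorticity-pocket rigidity

Re-homed for the scenario census (typer seat ns-census-typer-1 g10; the cells A2inV / A2inP / A2inT / A2inB / A2inA / A2inW are MEMBERS OF RECORD «DECIDED IN KERNEL IN FILES» of row A2
(item 88: critic idea-crit-3 g10 PASS no price 13:11:05Z; ref ns-census-ref g15 PRE-CHECK ✓ §20.4; lead label v1.120; OF RECORD 4/4 at v1.122), A2inS / A2inG OPEN (typed); this port makes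
the decided cells TREE-decided): VERBATIM PORT of ns-idea-2 LINE g18-1 «inertial-meter», `pub/ideators/ns-idea-2/lines/inertial-meter/line-inertial-meter.lean` sha16 78017c94d7e034e6
(708 l., lean check rc 0, 0 sorry), split for the 400-line rule into `ScenarioCensusInertialMeter` (§A–§D) → `…InertialMeterAccel` (§E–§F) → `…InertialMeterRows` (§G + census KEYS).  Lean text VERBATIM in
namespace `…Theorems.ScenarioCensus.InertialMeter` (the line's `…Lines.InertialMeter` re-homed); port edits: the line's `local notation "E3"` is spelled as the reducible `abbrev E3` of
every census file; elementary lemmas the line restates are the tree's BY NAME (gate lint dedup.landed): `integrableOn_ball_of_continuous` = `Wu2026Salvage.integrableOn_ball_of_continuous`,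
`volume_real_ball` = `volume_real_ball_eq` (Literature, Lei–Zhang 2011 proofs), `curl_sub_apply` = `UnthreadedRigidity.ThreadingJets.curl_fun_sub`, `curl_comp_add_right` = `StrainDoors.curl_comp_add_right_apply` (their modules are imported; none imports a route file);
`volume_real_unitBall_pos` (twin of a lemma in a route-cone module) and `divergence_sub_apply` (twin of a Literature lemma whose module is outside this closure) are not re-declared, their short proofs are inlined at the use sites; `set_option linter.unusedVariables false` dropped;
`@[conjecture]` on the OPEN rows `Row_A2inS`, `Row_A2inG`; one-line docstrings added where missing (gate lint).  Statements untouched.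

No census VALUE is moved here (row A2 stays OPEN-WITH-LINE; the members become TREE-decided by name); (L′) is NOT proved; no summit statement is proved by this file. Lemmas that restate already-landed tree declarations are taken BY NAME (gate lint `dedup.landed`): `integrableOn_ball_of_continuous` = `Wu2026Salvage.integrableOn_ball_of_continuous`, `volume_real_ball` = `volume_real_ball_eq`, `curl_sub_apply` = `UnthreadedRigidity.ThreadingJets.curl_fun_sub`, `curl_comp_add_right` = `StrainDoors.curl_comp_add_right_apply`.
-/

-- the summit and its single problem share the name `NavierStokesRegularity` (D-0017 nested layout)
set_option linter.dupNamespace false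

noncomputable section

open Set Function Filter Metric MeasureTheory
open scoped Topology
open Literature.Analysis Literature.Analysis.FluidPDE
open Summit.NavierStokesRegularity.NavierStokesRegularity.Theorems
open Summit.NavierStokesRegularity.NavierStokesRegularity.Theorems.ScenarioCensus

namespace Summit.NavierStokesRegularity.NavierStokesRegularity.Theorems.ScenarioCensus.InertialMeter

/-- `ℝ³` (the line's `local notation "E3"`, spelled as a reducible abbreviation for the tree). -/
abbrev E3 := EuclideanSpace ℝ (Fin 3)

-- the summit namespace `…NavierStokesRegularity.NavierStokesRegularity…` is the tree convention (D-0017)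

variable {C C' : ℝ} {u v : ℝ → E3 → E3}

/-! ## A. The instrument's LAW: the KNSS gauge is an inertial frame (zero large-scale mean) -/

-- `integrableOn_ball_of_continuous`: the line restates the tree's `Wu2026Salvage.integrableOn_ball_of_continuous`; taken BY NAME (gate lint dedup.landed).

/-- AM–GM: `‖v‖ ≤ ε/2 + ‖v‖²/(2ε)`. -/
theorem norm_le_amgm (w : E3) {ε : ℝ} (hε : 0 < ε) : ‖w‖ ≤ ε / 2 + (2 * ε)⁻¹ * ‖w‖ ^ 2 := by
  have h2 : (0 : ℝ) < 2 * ε := by positivity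
  have hinv : (2 * ε)⁻¹ * (2 * ε) = 1 := inv_mul_cancel₀ h2.ne'
  have e : (ε / 2 + (2 * ε)⁻¹ * ‖w‖ ^ 2) * (2 * ε) = ε ^ 2 + ‖w‖ ^ 2 := by
    linear_combination (‖w‖ ^ 2) * hinv
  refine le_of_mul_le_mul_right ?_ h2
  rw [e]
  nlinarith [sq_nonneg (‖w‖ - ε)]

-- `volume_real_ball`: the line restates the tree's `volume_real_ball_eq`; taken BY NAME (gate lint dedup.landed).

-- `volume_real_unitBall_pos`: a statement-twin of the landed `AdaptedFrequencyConverges.CloudFrameEffectiveTsai.doeblin_volume_unitBall_pos` (route-cone module, NOT imported); not re-declared — its two-line proof is inlined at the two use sites.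

/-- Balls of `ℝ³` have positive volume. -/
theorem volume_real_ball_pos (x₀ : E3) {R : ℝ} (hR : 0 < R) : 0 < volume.real (ball x₀ R) := by
  rw [volume_real_ball_eq x₀ hR]
  exact mul_pos (pow_pos hR 3) (by
    rw [measureReal_def, ENNReal.toReal_pos_iff]
    exact ⟨measure_ball_pos volume (0 : E3) one_pos, measure_ball_lt_top⟩)

/-- AM–GM under the integral: `‖∫_{B} f‖ ≤ (ε/2)|B| + (2ε)⁻¹ ∫_B ‖f‖²` for continuous `f`. -/
theorem norm_setIntegral_ball_le {f : E3 → E3} (hf : Continuous f) (x₀ : E3) (R : ℝ) {ε : ℝ}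
    (hε : 0 < ε) :
    ‖∫ x in ball x₀ R, f x‖ ≤
      ε / 2 * volume.real (ball x₀ R) + (2 * ε)⁻¹ * ∫ x in ball x₀ R, ‖f x‖ ^ 2 := by
  have hint : IntegrableOn f (ball x₀ R) volume := Wu2026Salvage.integrableOn_ball_of_continuous hf x₀ R
  have hn : IntegrableOn (fun x => ‖f x‖) (ball x₀ R) volume := hint.norm
  have hsq : IntegrableOn (fun x => ‖f x‖ ^ 2) (ball x₀ R) volume :=
    Wu2026Salvage.integrableOn_ball_of_continuous (hf.norm.pow 2) x₀ R
  have hc : IntegrableOn (fun _ : E3 => ε / 2) (ball x₀ R) volume :=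
    Wu2026Salvage.integrableOn_ball_of_continuous continuous_const x₀ R
  calc ‖∫ x in ball x₀ R, f x‖ ≤ ∫ x in ball x₀ R, ‖f x‖ := norm_integral_le_integral_norm _
    _ ≤ ∫ x in ball x₀ R, (ε / 2 + (2 * ε)⁻¹ * ‖f x‖ ^ 2) :=
        setIntegral_mono_on hn (hc.add (hsq.const_mul _)) measurableSet_ball
          (fun x _ => norm_le_amgm (f x) hε)
    _ = ε / 2 * volume.real (ball x₀ R) + (2 * ε)⁻¹ * ∫ x in ball x₀ R, ‖f x‖ ^ 2 := by
        rw [integral_add hc (hsq.const_mul _), setIntegral_const, integral_const_mul, smul_eq_mul]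
        ring

/-- **THE INERTIAL LAW.**  Every slice of every element of `A_C` has zero large-scale mean:
`⨍_{B_R(x₀)} u(t,x) dx → 0` as `R → ∞`, for every `t < 0` and every centre `x₀`.  From the tree's
far-past energy ledger `FarPastLedger_proof` (`∫_{B_R(x₀)} ‖u(t)‖² ≤ K(C)·R`): with AM–GM,
`‖⨍_{B_R} u(t)‖ ≤ ε/2 + K/(2 ε |B_1| R²)`. -/
theorem inertialLaw (hu : IsTypeIAncientMild C u) {t : ℝ} (ht : t < 0) (x₀ : E3) :
    Tendsto (fun R : ℝ => ⨍ x in ball x₀ R, u t x) atTop (𝓝 0) := by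
  obtain ⟨K, hK⟩ := FarPastLedger_proof C
  set v₁ : ℝ := volume.real (ball (0 : E3) 1) with hv₁
  have hv₁pos : 0 < v₁ := by
    rw [hv₁, measureReal_def, ENNReal.toReal_pos_iff]
    exact ⟨measure_ball_pos volume (0 : E3) one_pos, measure_ball_lt_top⟩
  rw [NormedAddGroup.tendsto_nhds_zero]
  intro ε hε
  filter_upwards [eventually_ge_atTop (1 : ℝ), eventually_gt_atTop (K / (ε ^ 2 * v₁))] with R hR1 hRK
  have hR : 0 < R := by linarith
  have hvol : volume.real (ball x₀ R) = R ^ 3 * v₁ := volume_real_ball_eq x₀ hR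
  have hvpos : 0 < volume.real (ball x₀ R) := volume_real_ball_pos x₀ hR
  have h1 := norm_setIntegral_ball_le (hu.continuous_slice ht) x₀ R hε
  have h2 := hK u hu t ht x₀ R hR
  have h3 : ‖∫ x in ball x₀ R, u t x‖ ≤ ε / 2 * volume.real (ball x₀ R) + (2 * ε)⁻¹ * (K * R) :=
    h1.trans (by gcongr)
  rw [setAverage_eq, norm_smul, norm_inv, Real.norm_of_nonneg hvpos.le]
  have hKlt : K < ε ^ 2 * v₁ * R := by
    have := (div_lt_iff₀ (by positivity : (0 : ℝ) < ε ^ 2 * v₁)).1 hRK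
    linarith
  have hR2 : R ≤ R ^ 2 := by nlinarith
  calc (volume.real (ball x₀ R))⁻¹ * ‖∫ x in ball x₀ R, u t x‖
      ≤ (volume.real (ball x₀ R))⁻¹ * (ε / 2 * volume.real (ball x₀ R) + (2 * ε)⁻¹ * (K * R)) :=
        mul_le_mul_of_nonneg_left h3 (inv_nonneg.2 hvpos.le)
    _ = ε / 2 + K / (2 * ε * v₁ * R ^ 2) := by
        rw [hvol]
        field_simp
    _ < ε := by
        have hlt : K / (2 * ε * v₁ * R ^ 2) < ε / 2 := by
          rw [div_lt_iff₀ (by positivity)]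
          nlinarith [mul_pos (mul_pos hε hε) hv₁pos]
        linarith

/-- Average of `f − g − c` over a ball = average of `f` − average of `g` − `c` (`R > 0`). -/
theorem setAverage_ball_sub_sub_const {f g : E3 → E3} (hf : Continuous f) (hg : Continuous g)
    (c x₀ : E3) {R : ℝ} (hR : 0 < R) :
    ⨍ x in ball x₀ R, (f x - g x - c) =
      (⨍ x in ball x₀ R, f x) - (⨍ x in ball x₀ R, g x) - c := by
  have hfi := Wu2026Salvage.integrableOn_ball_of_continuous hf x₀ R
  have hgi := Wu2026Salvage.integrableOn_ball_of_continuous hg x₀ R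
  have hci : IntegrableOn (fun _ : E3 => c) (ball x₀ R) volume :=
    Wu2026Salvage.integrableOn_ball_of_continuous continuous_const x₀ R
  have hfg : IntegrableOn (fun x => f x - g x) (ball x₀ R) volume := hfi.sub hgi
  have hvne : volume.real (ball x₀ R) ≠ 0 := (volume_real_ball_pos x₀ hR).ne'
  simp only [setAverage_eq]
  rw [integral_sub hfg hci, integral_sub hfi hgi, setIntegral_const, smul_sub, smul_sub,
    inv_smul_smul₀ hvne]

/-- **No boosts between slices of the class.**  If two continuous fields with zero large-scale mean
differ by a constant vector `b`, then `b = 0`. -/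
theorem boost_eq_zero {f g : E3 → E3} (hf : Continuous f) (hg : Continuous g) {x₀ : E3}
    (hfm : Tendsto (fun R : ℝ => ⨍ x in ball x₀ R, f x) atTop (𝓝 0))
    (hgm : Tendsto (fun R : ℝ => ⨍ x in ball x₀ R, g x) atTop (𝓝 0)) {b : E3}
    (h : ∀ x, f x = g x + b) : b = 0 := by
  have hlim : Tendsto (fun R : ℝ => (⨍ x in ball x₀ R, f x) - (⨍ x in ball x₀ R, g x) - b) atTop
      (𝓝 (0 - 0 - b)) := (hfm.sub hgm).sub tendsto_const_nhds
  have hev : ∀ᶠ R in atTop, (⨍ x in ball x₀ R, f x) - (⨍ x in ball x₀ R, g x) - b = 0 := by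
    filter_upwards [eventually_gt_atTop (0 : ℝ)] with R hR
    rw [← setAverage_ball_sub_sub_const hf hg b x₀ hR]
    have : (fun x => f x - g x - b) = fun _ => (0 : E3) := by
      funext x; rw [h x]; abel
    rw [this, setAverage_const (measure_ball_pos volume x₀ hR).ne' measure_ball_lt_top.ne]
  have h0 : Tendsto (fun R : ℝ => (⨍ x in ball x₀ R, f x) - (⨍ x in ball x₀ R, g x) - b) atTop (𝓝 0) :=
    tendsto_const_nhds.congr' (EventuallyEq.symm hev)
  have := tendsto_nhds_unique hlim h0
  simpa using this

/-- Two slices of two class elements that differ by a constant vector are EQUAL (`b = 0`). -/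
theorem boost_eq_zero_of_slices (hv : IsTypeIAncientMild C' v) (hu : IsTypeIAncientMild C u)
    {s t : ℝ} (hs : s < 0) (ht : t < 0) {b : E3} (h : ∀ x, v s x = u t x + b) : b = 0 :=
  boost_eq_zero (hv.continuous_slice hs) (hu.continuous_slice ht) (inertialLaw hv hs 0)
    (inertialLaw hu ht 0) h

/-! ## B. Kinematics: fields read modulo boosts and potentials -/

-- `curl_sub_apply`: the line restates the tree's `UnthreadedRigidity.ThreadingJets.curl_fun_sub`; taken BY NAME (gate lint dedup.landed).

-- `divergence_sub_apply`: a statement-twin of the landed `Literature.Analysis.FluidPDE.EulerReynoldsLadder.divergence_sub_apply` (module `EulerReynoldsLadderGluingBlend`, not in this file's import closure and not built with it); not re-declared — its one-line proof is inlined at the single use site in `vorticityPocketRigidity`.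

/-- **Vector Liouville modulo the Galilean algebra.**  A bounded `C²` field on `ℝ³` which is curl-free AND
divergence-free is CONSTANT (its components are bounded harmonic functions: `Δ = −curl curl + ∇div`). -/
theorem const_of_curlFree_divFree_bounded {w : E3 → E3} (hw : ContDiff ℝ 2 w)
    (hcurl : ∀ x, curl w x = 0) (hdiv : VectorCalculus.IsDivFree w) (hB : ∃ B, ∀ x, ‖w x‖ ≤ B)
    (x y : E3) : w x = w y := by
  refine ForceMeter.const_of_laplacian_eq_zero_of_bounded hw (fun z => ?_) hB x y
  rw [laplacian_eq_neg_curl_curl hw hdiv z]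
  have hc : curl w = fun _ => (0 : E3) := funext hcurl
  rw [hc, ForceMeter.curl_const_eq_zero, neg_zero]

/-! ## C. The class read by the meter: VORTICITY-POCKET RIGIDITY -/

/-- Slices of class elements are `C²`. -/
theorem contDiff_two_slice (hu : IsTypeIAncientMild C u) {t : ℝ} (ht : t < 0) : ContDiff ℝ 2 (u t) :=
  (hu.contDiff_slice ht).of_le (by norm_cast)

/-- Slices of members of the class are differentiable. -/
theorem differentiable_slice (hu : IsTypeIAncientMild C u) {t : ℝ} (ht : t < 0) :
    Differentiable ℝ (u t) :=
  (hu.contDiff_slice ht).differentiable (by simp)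

/-- **VORTICITY-POCKET RIGIDITY (the meter's master theorem).**  Let `v ∈ A_{C′}` and `u ∈ A_C` and suppose
the vorticities of their slices at ONE time `t₀ < 0` agree on a nonempty open set `U`.  Then `v ≡ u` on
`(−∞, 0) × ℝ³`.  Proof: `w = v(t₀) − u(t₀)` is analytic with analytic curl vanishing on `U`, hence
curl-free on `ℝ³` (identity theorem); it is divergence-free and bounded, hence CONSTANT (§B); the constant
is a boost between two slices of the class, hence `0` (inertial law, §A); so the VELOCITY slices agree and
the tree's `germRigidity` propagates the equality to all times. -/
theorem vorticityPocketRigidity (hv : IsTypeIAncientMild C' v) (hu : IsTypeIAncientMild C u)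
    {t₀ : ℝ} (ht₀ : t₀ < 0) {U : Set E3} (hU : IsOpen U) (hne : U.Nonempty)
    (heq : ∀ x ∈ U, curl (v t₀) x = curl (u t₀) x) {t : ℝ} (ht : t < 0) (x : E3) :
    v t x = u t x := by
  -- the difference of the two slices
  set w : E3 → E3 := fun y => v t₀ y - u t₀ y with hw
  have hva := hv.analyticOnNhd_slice_univ ht₀
  have hua := hu.analyticOnNhd_slice_univ ht₀
  have hwa : AnalyticOnNhd ℝ w univ := fun y hy => (hva y hy).sub (hua y hy)
  have hw2 : ContDiff ℝ 2 w := (contDiff_two_slice hv ht₀).sub (contDiff_two_slice hu ht₀)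
  -- curl-free on the pocket, hence everywhere
  have hcurlU : ∀ y ∈ U, curl w y = 0 := fun y hy => by
    rw [hw, UnthreadedRigidity.ThreadingJets.curl_fun_sub (differentiable_slice hv ht₀ y) (differentiable_slice hu ht₀ y), heq y hy,
      sub_self]
  have hcurl : ∀ y, curl w y = 0 :=
    ForceMeter.eq_zero_of_window (analyticOnNhd_curl hwa) hU hne hcurlU
  -- divergence-free and bounded
  have hdiv : VectorCalculus.IsDivFree w := fun y => by
    have hds : VectorCalculus.divergence (fun z => v t₀ z - u t₀ z) y =
        VectorCalculus.divergence (v t₀) y - VectorCalculus.divergence (u t₀) y := by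
      simp only [VectorCalculus.divergence, fderiv_fun_sub (differentiable_slice hv ht₀ y) (differentiable_slice hu ht₀ y),
        ContinuousLinearMap.toLinearMap_sub, map_sub]
    rw [hw, hds,
      hv.2.1 t₀ ht₀ y, hu.2.1 t₀ ht₀ y, sub_self]
  have hB : ∃ B, ∀ y, ‖w y‖ ≤ B :=
    ⟨C' / Real.sqrt (-t₀) + C / Real.sqrt (-t₀), fun y =>
      (norm_sub_le _ _).trans (add_le_add (hv.norm_le ht₀ y) (hu.norm_le ht₀ y))⟩
  -- hence constant, and the constant is a boost between slices of the class: zero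
  have hconst : ∀ y, w y = w 0 := fun y => const_of_curlFree_divFree_bounded hw2 hcurl hdiv hB y 0
  have hb : w 0 = 0 := by
    refine boost_eq_zero_of_slices hv hu ht₀ ht₀ (b := w 0) fun y => ?_
    have h1 : v t₀ y - u t₀ y = w 0 := hconst y
    exact sub_eq_iff_eq_add'.1 h1
  have hslice : ∀ y, v t₀ y = u t₀ y := fun y => by
    have h1 : v t₀ y - u t₀ y = w 0 := hconst y
    rw [hb, sub_eq_zero] at h1
    exact h1
  exact germRigidity hv hu ht₀ isOpen_univ univ_nonempty (fun y _ => hslice y) ht x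

/-! ## D. The cells decided by vorticity-pocket rigidity -/

/-- **Vorticity recurring in time on a pocket kills.**  If `curl u(t₀,·) = curl u(t₀ − δ,·)` on a nonempty
open set (`δ > 0`, one `t₀ < 0`), then `u ≡ 0`: rigidity against the time-shifted copy `u(· − δ) ∈ A_C`
gives the VELOCITY recurrence `u(t₀ − δ) = u(t₀)` on `ℝ³`, and the tree's `eq_zero_of_germ_timeRecurrent`
(time-periodic Type-I elements vanish) concludes. -/
theorem eq_zero_of_vorticityRecurrent_pocket (hu : IsTypeIAncientMild C u) {δ : ℝ} (hδ : 0 < δ)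
    {t₀ : ℝ} (ht₀ : t₀ < 0) {U : Set E3} (hU : IsOpen U) (hne : U.Nonempty)
    (heq : ∀ x ∈ U, curl (u t₀) x = curl (u (t₀ - δ)) x) : ∀ t < 0, ∀ x, u t x = 0 := by
  have hv : IsTypeIAncientMild C (fun s y => u (s - δ) y) := hu.comp_sub_right hδ.le
  have hrec : ∀ y, u (t₀ - δ) y = u t₀ y := fun y =>
    vorticityPocketRigidity hv hu ht₀ hU hne (fun x hx => (heq x hx).symm) ht₀ y
  exact eq_zero_of_germ_timeRecurrent hu hδ ht₀ isOpen_univ univ_nonempty fun y _ => hrec y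

-- `curl_comp_add_right`: the line restates the tree's `StrainDoors.curl_comp_add_right_apply`; taken BY NAME (gate lint dedup.landed).

/-- **Vorticity of one slice periodic on a pocket kills.**  If `curl u(t₀, x + a) = curl u(t₀, x)` for `x`
in a nonempty open set (`a ≠ 0`), then `u ≡ 0`: rigidity against the translate `u(·, · + a) ∈ A_C` makes
`u` EXACTLY `a`-periodic at all times, and census A13 (`PeriodicGauge.periodic_typeI_liouville_genuine`,
tree) kills periodic Type-I elements. -/
theorem eq_zero_of_vorticityPeriodic_pocket (hu : IsTypeIAncientMild C u) {a : E3} (ha : a ≠ 0)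
    {t₀ : ℝ} (ht₀ : t₀ < 0) {U : Set E3} (hU : IsOpen U) (hne : U.Nonempty)
    (heq : ∀ x ∈ U, curl (u t₀) (x + a) = curl (u t₀) x) : ∀ t < 0, ∀ x, u t x = 0 := by
  have hv : IsTypeIAncientMild C (fun s y => u s (y + a)) :=
    translationInvariantAfter_isTypeIAncientMild_comp_add_right hu a
  have hper : ∀ t < 0, ∀ y, u t (y + a) = u t y := fun t ht y =>
    vorticityPocketRigidity hv hu ht₀ hU hne (fun x hx => by
      show curl (fun y => u t₀ (y + a)) x = curl (u t₀) x
      rw [StrainDoors.curl_comp_add_right_apply, heq x hx]) ht y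
  exact PeriodicGauge.periodic_typeI_liouville_genuine C u hu a ha hper

/-- **PLACEMENT: a vorticity-DSS pocket makes the element exactly DSS** (census D7; no vanishing claimed).
If the vorticity of ONE slice agrees on a pocket with that of the parabolic rescaling `u_λ(t,x) = λu(λ²t, λx)`
(`λ > 0`), then `u_λ ≡ u`. -/
theorem dss_of_vorticityDssPocket (hu : IsTypeIAncientMild C u) {c : ℝ} (hc : 0 < c) {t₀ : ℝ}
    (ht₀ : t₀ < 0) {U : Set E3} (hU : IsOpen U) (hne : U.Nonempty)
    (heq : ∀ x ∈ U, curl (nsRescale c u t₀) x = curl (u t₀) x) {t : ℝ} (ht : t < 0) (x : E3) :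
    nsRescale c u t x = u t x :=
  vorticityPocketRigidity (zoom_isTypeIAncientMild hu hc) hu ht₀ hU hne heq ht x

/-- **PLACEMENT: a vorticity pocket symmetric under a linear isometry makes the element exactly
equivariant** at all times (rotation / reflection cells of the census; no vanishing claimed here). -/
theorem isometryInvariant_of_vorticityPocket (hu : IsTypeIAncientMild C u) (L : E3 ≃ₗᵢ[ℝ] E3) {t₀ : ℝ}
    (ht₀ : t₀ < 0) {U : Set E3} (hU : IsOpen U) (hne : U.Nonempty)
    (heq : ∀ x ∈ U, curl (fun y => L (u t₀ (L.symm y))) x = curl (u t₀) x) {t : ℝ} (ht : t < 0)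
    (x : E3) : L (u t (L.symm x)) = u t x :=
  vorticityPocketRigidity (u := u) (v := fun s y => L (u s (L.symm y)))
    (SymmetryModuliCountSymmetricLiouville.isTypeIAncientMild_conj_linearIsometryEquiv hu L) hu ht₀ hU hne
    heq ht x

/-- **BOOSTED twin (time): a germ recurring in time UP TO A CONSTANT VECTOR kills.**  If
`u(t₀, x) = u(t₀ − δ, x) + b` on a nonempty open set (`δ > 0`), then `u ≡ 0` (the boost is invisible to
the vorticity: sub-case of `eq_zero_of_vorticityRecurrent_pocket`). -/
theorem eq_zero_of_boostedRecurrent_germ (hu : IsTypeIAncientMild C u) {δ : ℝ} (hδ : 0 < δ) {t₀ : ℝ}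
    (ht₀ : t₀ < 0) {U : Set E3} (hU : IsOpen U) (hne : U.Nonempty) {b : E3}
    (heq : ∀ x ∈ U, u t₀ x = u (t₀ - δ) x + b) : ∀ t < 0, ∀ x, u t x = 0 := by
  refine eq_zero_of_vorticityRecurrent_pocket hu hδ ht₀ hU hne fun x hx => ?_
  have hev : (u t₀) =ᶠ[𝓝 x] fun y => u (t₀ - δ) y + b :=
    Filter.eventually_of_mem (hU.mem_nhds hx) fun y hy => heq y hy
  rw [curl_eq_curlCLM, curl_eq_curlCLM, hev.fderiv_eq, fderiv_add_const]

/-- **BOOSTED twin (space): a germ recurring under a translation UP TO A CONSTANT VECTOR kills.**  If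
`u(t₀, x + a) = u(t₀, x) + b` on a nonempty open set (`a ≠ 0`), then `u ≡ 0`. -/
theorem eq_zero_of_boostedPeriodic_germ (hu : IsTypeIAncientMild C u) {a : E3} (ha : a ≠ 0) {t₀ : ℝ}
    (ht₀ : t₀ < 0) {U : Set E3} (hU : IsOpen U) (hne : U.Nonempty) {b : E3}
    (heq : ∀ x ∈ U, u t₀ (x + a) = u t₀ x + b) : ∀ t < 0, ∀ x, u t x = 0 := by
  refine eq_zero_of_vorticityPeriodic_pocket hu ha ht₀ hU hne fun x hx => ?_
  have hev : (fun y => u t₀ (y + a)) =ᶠ[𝓝 x] fun y => u t₀ y + b :=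
    Filter.eventually_of_mem (hU.mem_nhds hx) fun y hy => heq y hy
  rw [← StrainDoors.curl_comp_add_right_apply, curl_eq_curlCLM, curl_eq_curlCLM, hev.fderiv_eq, fderiv_add_const]

end Summit.NavierStokesRegularity.NavierStokesRegularity.Theorems.ScenarioCensus.InertialMeter

end
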